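import Summits.QuantumFields.BalabanUV.T4Continuum.Support.VariationalVectorForm
import Summits.QuantumFields.BalabanUV.T4Continuum.Support.VariationalCovariantTower

/-!
# T⁴ programme, spine node NE2 (U1a), lane P2 — THE VECTOR SECTOR READ IN ROW NE2's CONSUMER CURRENCY (road owner, skeleton §2.E ∕ §0):
# leaf D for 1-forms (the block-spin value of the fixed vector form `ScV` is the Hermitian form of an effective operator on the unit index
# `Tor M × Fin d`), and THE VECTOR TOWER END MODULO THE PER-LEVEL BRACKETS: `TowerLimitRate (fun _ ↦ 1) 1 (k ↦ X^V_k) C ρ`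

Road owner `b2b-balaban-t4-ne2-p2` gen 11; on top of the owner's `VariationalVectorForm` (the form `ScV`, decisions (D1)–(D4), the vector
canonical-pair bracket `vector_pair_bracket_sqrt`) and of the type-generic effective-operator layer `VariationalEffectiveOperator`
(`effOp`, `blockSpin_eq_effOp`, `oneStepAveragedLaw_effOp`) ∕ `CovariantAveragingTower.towerLimitRate_of_oneStepAveragedLaw` — BY NAME; the
scalar twin is `VariationalCovariantEffective` ∕ `VariationalCovariantTower` (same lines, index `Tor M`).

MODEL LEVEL, `E = ℂ` (U(1) data, as the scalar END): 1-forms `W : Tor N → Fin d → ℂ`, bond transports `R : Tor N → Fin d → (ℂ →L[ℂ] ℂ)`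
(the `E = ℂ` instance of `VariationalVectorForm`'s data), the gauge∕curvature functional GIVEN BY A PSD MATRIX `Gm` on the product index
(`G W = qform Gm (unc W)`), and the AVERAGING GIVEN BY A MATRIX `Qm : Matrix (Tor M × Fin d) (Tor (fine n M) × Fin d) ℂ` acting on uncurried
1-forms (`avg Qm W = cur (Qm *ᵥ unc W)`; the line-indexed `QvL` and the bond-indexed `QvT` of leaf-03-g4 are both of this form — linear).
 * §1 `unc`∕`cur` (the product-index presentation), `nsq_unc : nsq (unc φ) = nsqV M φ`, `blockSpin_relabel` (both carriers relabelled);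
 * §2 the curl as a matrix: `curlLin` (ℂ-linear), `curlM := LinearMap.toMatrix' curlLin`, `Kcurl := curlMᴴ·curlM` (PSD), `qform_Kcurl = curlSq`;
 * §3 `KV n M R Gm := (n²/n^d) • (½Kcurl + Gm)` with `ScV_eq_qform : ScV n M R G W = qform (KV …) (unc W)` under `G = qform Gm ∘ unc`, PSD;
 * §4 KER from leaf V-P's shape, surjectivity transfer, **`effV n M R Gm Qm a := effOp (KV n M R Gm) Qm a`**, `effV_isHermitian`,
   **`blockSpin_ScV_eq`** (LEAF D-V: `blockSpin (avg Qm) (ScV R G) φ = re ⟨unc φ, X^V unc φ⟩`);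
 * §5 **`towerLimitRate_effV`** — along `n_k = L^k` with data `(R k, Gm k, Qm k)`: V-P-shaped coercivity per level, `Qm k` onto, and the two
   one-sided additive brackets between CONSECUTIVE LEVELS' vector block-spin values with defects `≤ C·ρ^k` (the conclusion of
   `vector_pair_bracket_sqrt` composed with leaf V-COMP's identification of level `k+1` with the composite — displayed) ⟹
   `TowerLimitRate (ι := fun _ ↦ Tor M × Fin d) (fun _ ↦ 1) 1 (k ↦ effV (L^k) M (R k) (Gm k) (Qm k) a) C ρ` — ROW NE2's currency for the vector
   covariant species, MODULO the vector leaves.  Nothing of NE3.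

HONEST FRAMING (T4-DAG p. 1).  Model level (U(1), `E = ℂ`); `R`, `Gm`, `Qm` DATA; the brackets, coercivity and surjectivity are DISPLAYED hypotheses
(the vector leaves V-UB∕V-P∕V-FED∕V-ONE∕V-REG∕V-COMP of skeleton §2.E, not proved here); [folklore] linear algebra; data `def`s only (`unc`, `cur`,
`curlLin`, `curlM`, `Kcurl`, `KV`, `avg`, `effV`), no `def … : Prop`, no `sorry`; axioms standard.  NE2 NOT proved; spine 0/9; rung (B)+1 finite T⁴ —
NOT infinite volume, NOT mass gap, NOT Clay.  HONEST DEPENDENCY (cell, verbatim): continuum YM on T⁴ ⇐ BetaPertH ∧ nine spine estimates (0/9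
proved); BetaPertH ⇐ (D1) ∧ (D4) ∧ CAP+tail; G-an2-4 gates asym, D1 and NE2/3/4.
-/

noncomputable section

namespace Summit.QuantumFields.BalabanUV.T4Continuum.VariationalVectorEffective

open Finset
open scoped Matrix ComplexConjugate ComplexOrder Matrix.Norms.L2Operator BigOperators
open Literature.MathematicalPhysics.QuantumFieldTheory.Balaban1983to89.B5Prop11Plancherel (Tor fine unitVec)
open Literature.MathematicalPhysics.QuantumFieldTheory.Balaban1983to89.B5Prop11Lower (nsq nsq_nonneg star_dotProduct_self)
open Literature.Analysis.Complex (qform qform_add qform_smul qform_nonneg_of_posSemidef)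
open Summit.QuantumFields.BalabanUV.T4Continuum.VariationalTransfer (blockSpin fib mem_fib)
open Summit.QuantumFields.BalabanUV.T4Continuum.VariationalTower (blockSpin_equiv)
open Summit.QuantumFields.BalabanUV.T4Continuum.VariationalEffectiveOperator
open Summit.QuantumFields.BalabanUV.T4Continuum.BalabanAveragedCoerciveFibre (star_dotProduct_conjTranspose_mulVec)
open Summit.QuantumFields.BalabanUV.T4Continuum.CovariantAveragingTower (OneStepAveragedLaw TowerLimitRate
  towerLimitRate_of_oneStepAveragedLaw opNorm_one_le)
open Summit.QuantumFields.BalabanUV.T4Continuum.VectorBlockTrialForm (nsqV nsqV_nonneg)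
open Summit.QuantumFields.BalabanUV.T4Continuum.VariationalVectorForm

variable {d : ℕ}

/-! ## §1 The product-index presentation of 1-forms and the block-spin value under relabelling -/

section Curry

/-- uncurrying a 1-form into a vector over the product index. [folklore] -/
def unc {α β : Type*} (W : α → β → ℂ) : α × β → ℂ := fun p => W p.1 p.2

/-- currying a vector over the product index into a 1-form. [folklore] -/
def cur {α β : Type*} (w : α × β → ℂ) : α → β → ℂ := fun a b => w (a, b)

/-- `cur ∘ unc = id`. [folklore] -/
@[simp] theorem cur_unc {α β : Type*} (W : α → β → ℂ) : cur (unc W) = W := rfl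

/-- `unc ∘ cur = id`. [folklore] -/
@[simp] theorem unc_cur {α β : Type*} (w : α × β → ℂ) : unc (cur w) = w := rfl

/-- the relabelling equivalence. [folklore] -/
def ucEquiv (α β : Type*) : (α → β → ℂ) ≃ (α × β → ℂ) := ⟨unc, cur, fun _ => rfl, fun _ => rfl⟩

/-- `unc` is additive. [folklore] -/
theorem unc_add {α β : Type*} (W W' : α → β → ℂ) : unc (W + W') = unc W + unc W' := rfl

/-- `unc` is homogeneous. [folklore] -/
theorem unc_smul {α β : Type*} (c : ℂ) (W : α → β → ℂ) : unc (c • W) = c • unc W := rfl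

variable (M : Fin d → ℕ) [hM : ∀ μ, NeZero (M μ)]

/-- the `ℓ²` mass is the same in both presentations: `nsq (unc φ) = nsqV φ`. [folklore] -/
theorem nsq_unc (φ : Tor M → Fin d → ℂ) : nsq (unc φ) = nsqV M φ := by
  unfold nsq nsqV unc; rw [Fintype.sum_prod_type]

omit hM in
/-- relabelling BOTH the fine carrier and the datum along equivalences compatible with the average and the action does not change the
block-spin value. [folklore] -/
theorem blockSpin_relabel {V V' W W' : Type*} (φ : V ≃ V') (ψ : W ≃ W') {Q : V → W} {Q' : V' → W'} {S : V → ℝ} {S' : V' → ℝ}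
    (hQ : ∀ A, Q' (φ A) = ψ (Q A)) (hS : ∀ A, S' (φ A) = S A) (B : W) : blockSpin Q' S' (ψ B) = blockSpin Q S B := by
  have hfib : fib Q' (ψ B) = fib (ψ.symm ∘ Q') B := by
    ext A; simp only [mem_fib, Function.comp_apply, Equiv.symm_apply_eq]
  calc blockSpin Q' S' (ψ B) = blockSpin (ψ.symm ∘ Q') S' B := by unfold blockSpin; rw [hfib]
    _ = blockSpin Q S B := blockSpin_equiv φ (fun A => by simp [hQ A]) hS B

end Curry

/-! ## §2 The covariant curl as a matrix on the product index -/

section Curl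

variable (N : Fin d → ℕ) [∀ μ, NeZero (N μ)]

/-- the covariant curl as a ℂ-linear map `(Tor N × Fin d → ℂ) → (Tor N × Fin d × Fin d → ℂ)`. [folklore] -/
def curlLin (R : Tor N → Fin d → (ℂ →L[ℂ] ℂ)) : (Tor N × Fin d → ℂ) →ₗ[ℂ] (Tor N × Fin d × Fin d → ℂ) where
  toFun w p := curlV N R (cur w) p.1 p.2.1 p.2.2
  map_add' w w' := by funext p; simp only [curlV, cdV, cur, Pi.add_apply, map_add]; ring
  map_smul' c w := by
    have h : ∀ (f : ℂ →L[ℂ] ℂ) (v : ℂ), f (c * v) = c * f v := fun f v => by rw [← smul_eq_mul, map_smul, smul_eq_mul]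
    funext p; simp only [curlV, cdV, cur, Pi.smul_apply, smul_eq_mul, RingHom.id_apply, h]; ring

/-- the curl matrix. [folklore] -/
def curlM (R : Tor N → Fin d → (ℂ →L[ℂ] ℂ)) : Matrix (Tor N × Fin d × Fin d) (Tor N × Fin d) ℂ := LinearMap.toMatrix' (curlLin N R)

/-- the curl matrix acts as the curl. [folklore] -/
theorem curlM_mulVec (R : Tor N → Fin d → (ℂ →L[ℂ] ℂ)) (w : Tor N × Fin d → ℂ) (p : Tor N × Fin d × Fin d) :
    (curlM N R *ᵥ w) p = curlV N R (cur w) p.1 p.2.1 p.2.2 := by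
  rw [curlM, LinearMap.toMatrix'_mulVec]; rfl

/-- the matrix of the curl form `Kcurl := curlMᴴ·curlM`. [folklore] -/
def Kcurl (R : Tor N → Fin d → (ℂ →L[ℂ] ℂ)) : Matrix (Tor N × Fin d) (Tor N × Fin d) ℂ := (curlM N R)ᴴ * curlM N R

/-- `Kcurl` is positive semidefinite. [folklore] -/
theorem Kcurl_posSemidef (R : Tor N → Fin d → (ℂ →L[ℂ] ℂ)) : (Kcurl N R).PosSemidef := Matrix.posSemidef_conjTranspose_mul_self _

/-- the form of `Kcurl` is the curl form: `w† Kcurl w = curlSq (cur w)`. [folklore] -/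
theorem form_Kcurl (R : Tor N → Fin d → (ℂ →L[ℂ] ℂ)) (w : Tor N × Fin d → ℂ) :
    star w ⬝ᵥ (Kcurl N R *ᵥ w) = ((curlSq N R (cur w) : ℝ) : ℂ) := by
  rw [Kcurl, ← Matrix.mulVec_mulVec, star_dotProduct_conjTranspose_mulVec, star_dotProduct_self, nsq, curlSq]
  congr 1
  rw [Fintype.sum_prod_type]
  refine Finset.sum_congr rfl fun x _ => ?_
  rw [Fintype.sum_prod_type]
  exact Finset.sum_congr rfl fun μ _ => Finset.sum_congr rfl fun ν _ => by rw [curlM_mulVec]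

/-- `qform Kcurl w = curlSq (cur w)`. [folklore] -/
theorem qform_Kcurl (R : Tor N → Fin d → (ℂ →L[ℂ] ℂ)) (w : Tor N × Fin d → ℂ) : qform (Kcurl N R) w = curlSq N R (cur w) := by
  rw [qform, form_Kcurl, Complex.ofReal_re]

end Curl

/-! ## §3 The matrix of the fixed vector form -/

section Form

variable (n : ℕ) [NeZero n] (M : Fin d → ℕ) [hM : ∀ μ, NeZero (M μ)]

/-- **the matrix of `ScV`**: `KV R Gm = (n²/n^d) • (½·Kcurl R + Gm)`. [folklore] -/
def KV (R : Tor (fine n M) → Fin d → (ℂ →L[ℂ] ℂ)) (Gm : Matrix (Tor (fine n M) × Fin d) (Tor (fine n M) × Fin d) ℂ) :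
    Matrix (Tor (fine n M) × Fin d) (Tor (fine n M) × Fin d) ℂ :=
  (((n : ℝ) ^ 2 / (n : ℝ) ^ d : ℝ) : ℂ) • ((((1 : ℝ) / 2 : ℝ) : ℂ) • Kcurl (fine n M) R + Gm)

/-- `KV` is positive semidefinite when `Gm` is. [folklore] -/
theorem KV_posSemidef (R : Tor (fine n M) → Fin d → (ℂ →L[ℂ] ℂ)) {Gm : Matrix (Tor (fine n M) × Fin d) (Tor (fine n M) × Fin d) ℂ}
    (hGm : Gm.PosSemidef) : (KV n M R Gm).PosSemidef := by
  unfold KV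
  refine Matrix.PosSemidef.smul ?_ (Complex.zero_le_real.mpr (by positivity))
  exact (Matrix.PosSemidef.smul (Kcurl_posSemidef (fine n M) R) (Complex.zero_le_real.mpr (by positivity))).add hGm

/-- **`ScV = qform KV ∘ unc`** when the gauge∕curvature functional is the form of `Gm`. [folklore] -/
theorem ScV_eq_qform (R : Tor (fine n M) → Fin d → (ℂ →L[ℂ] ℂ)) {Gm : Matrix (Tor (fine n M) × Fin d) (Tor (fine n M) × Fin d) ℂ}
    {G : (Tor (fine n M) → Fin d → ℂ) → ℝ} (hG : ∀ W, G W = qform Gm (unc W)) (W : Tor (fine n M) → Fin d → ℂ) :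
    ScV n M R G W = qform (KV n M R Gm) (unc W) := by
  rw [KV, qform_smul, qform_add, qform_smul, qform_Kcurl, cur_unc, ← hG W, ScV]
  rw [div_eq_mul_inv, mul_comm ((n : ℝ) ^ 2)]; ring

/-- `qform (KV R Gm) w = ScV R G (cur w)`. [folklore] -/
theorem qform_KV_eq (R : Tor (fine n M) → Fin d → (ℂ →L[ℂ] ℂ)) {Gm : Matrix (Tor (fine n M) × Fin d) (Tor (fine n M) × Fin d) ℂ}
    {G : (Tor (fine n M) → Fin d → ℂ) → ℝ} (hG : ∀ W, G W = qform Gm (unc W)) (w : Tor (fine n M) × Fin d → ℂ) :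
    qform (KV n M R Gm) w = ScV n M R G (cur w) := by
  rw [ScV_eq_qform n M R hG, unc_cur]

end Form

/-! ## §4 The averaging as a matrix, KER from leaf V-P's shape, the effective operator, leaf D-V -/

section Effective

variable (n : ℕ) [NeZero n] (M : Fin d → ℕ) [hM : ∀ μ, NeZero (M μ)]

/-- the curried action of an averaging matrix on 1-forms: `avg Qm W = cur (Qm *ᵥ unc W)`. [folklore] -/
def avg (Qm : Matrix (Tor M × Fin d) (Tor (fine n M) × Fin d) ℂ) (W : Tor (fine n M) → Fin d → ℂ) : Tor M → Fin d → ℂ :=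
  cur (Qm *ᵥ unc W)

/-- `unc (avg Qm W) = Qm *ᵥ unc W`. [folklore] -/
theorem unc_avg (Qm : Matrix (Tor M × Fin d) (Tor (fine n M) × Fin d) ℂ) (W : Tor (fine n M) → Fin d → ℂ) :
    unc (avg n M Qm W) = Qm *ᵥ unc W := rfl

/-- surjectivity in the two presentations. [folklore] -/
theorem avg_surjective_iff (Qm : Matrix (Tor M × Fin d) (Tor (fine n M) × Fin d) ℂ) :
    Function.Surjective (avg n M Qm) ↔ Function.Surjective Qm.mulVec := by
  constructor
  · intro h μ
    obtain ⟨W, hW⟩ := h (cur μ)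
    exact ⟨unc W, by rw [← unc_avg, hW, unc_cur]⟩
  · intro h φ
    obtain ⟨w, hw⟩ := h (unc φ)
    exact ⟨cur w, by rw [avg, unc_cur, hw, cur_unc]⟩

/-- **KER from leaf V-P's coercivity shape**: `qWV W ≤ C_P·(ScV W + nsqV (avg Qm W))` forces `qform KV w = 0 ∧ Qm w = 0 ⇒ w = 0`. [folklore] -/
theorem ker_of_coercive (R : Tor (fine n M) → Fin d → (ℂ →L[ℂ] ℂ)) {Gm : Matrix (Tor (fine n M) × Fin d) (Tor (fine n M) × Fin d) ℂ}
    {G : (Tor (fine n M) → Fin d → ℂ) → ℝ} (hG : ∀ W, G W = qform Gm (unc W)) {Qm : Matrix (Tor M × Fin d) (Tor (fine n M) × Fin d) ℂ}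
    {CP : ℝ} (hP : ∀ W, qWV n M W ≤ CP * (ScV n M R G W + nsqV M (avg n M Qm W))) :
    ∀ w, qform (KV n M R Gm) w = 0 → Qm *ᵥ w = 0 → w = 0 := by
  intro w hS hQ
  have hnd : (0 : ℝ) < (n : ℝ) ^ d := by have := NeZero.ne n; positivity
  have hS' : ScV n M R G (cur w) = 0 := by rw [← qform_KV_eq n M R hG]; exact hS
  have hQ' : nsqV M (avg n M Qm (cur w)) = 0 := by rw [← nsq_unc, unc_avg, unc_cur, hQ]; simp [nsq]
  have h := hP (cur w)
  rw [hS', hQ'] at h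
  have h0 : qWV n M (cur w) ≤ 0 := by simpa using h
  refine eq_zero_of_nsq_le_zero ?_
  have hm : nsq w = nsqV (fine n M) (cur w) := by rw [← nsq_unc, unc_cur]
  unfold qWV at h0
  rw [hm]
  by_contra hne
  push Not at hne
  have : 0 < ((n : ℝ) ^ d)⁻¹ * nsqV (fine n M) (cur w) := mul_pos (inv_pos.mpr hnd) hne
  linarith

/-- **`X^V` — the Hermitian effective operator of the vector block-spin value** `φ ↦ min {ScV R G W : avg Qm W = φ}` on the unit index
`Tor M × Fin d` (auxiliary `a > 0`; the matrix does not depend on it, `effOp_eq_effOp`). [folklore] -/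
def effV (R : Tor (fine n M) → Fin d → (ℂ →L[ℂ] ℂ)) (Gm : Matrix (Tor (fine n M) × Fin d) (Tor (fine n M) × Fin d) ℂ)
    (Qm : Matrix (Tor M × Fin d) (Tor (fine n M) × Fin d) ℂ) (a : ℝ) : Matrix (Tor M × Fin d) (Tor M × Fin d) ℂ :=
  effOp (KV n M R Gm) Qm a

/-- `X^V` is Hermitian. [folklore] -/
theorem effV_isHermitian (R : Tor (fine n M) → Fin d → (ℂ →L[ℂ] ℂ)) {Gm : Matrix (Tor (fine n M) × Fin d) (Tor (fine n M) × Fin d) ℂ}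
    (hGm : Gm.PosSemidef) {G : (Tor (fine n M) → Fin d → ℂ) → ℝ} (hG : ∀ W, G W = qform Gm (unc W))
    {Qm : Matrix (Tor M × Fin d) (Tor (fine n M) × Fin d) ℂ} (hQ : Function.Surjective Qm.mulVec) {CP a : ℝ}
    (hP : ∀ W, qWV n M W ≤ CP * (ScV n M R G W + nsqV M (avg n M Qm W))) (ha : 0 < a) : (effV n M R Gm Qm a).IsHermitian :=
  effOp_isHermitian (KV_posSemidef n M R hGm) hQ (ker_of_coercive n M R hG hP) ha

/-- **LEAF D-V**: `blockSpin (avg Qm) (ScV R G) φ = re ⟨unc φ, X^V unc φ⟩` — the vector block-spin value over the full fibre is the Hermitian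
form of the effective operator (decision (D1): no constraint subspace). [folklore] -/
theorem blockSpin_ScV_eq (R : Tor (fine n M) → Fin d → (ℂ →L[ℂ] ℂ)) {Gm : Matrix (Tor (fine n M) × Fin d) (Tor (fine n M) × Fin d) ℂ}
    (hGm : Gm.PosSemidef) {G : (Tor (fine n M) → Fin d → ℂ) → ℝ} (hG : ∀ W, G W = qform Gm (unc W))
    {Qm : Matrix (Tor M × Fin d) (Tor (fine n M) × Fin d) ℂ} (hQ : Function.Surjective Qm.mulVec) {CP a : ℝ}
    (hP : ∀ W, qWV n M W ≤ CP * (ScV n M R G W + nsqV M (avg n M Qm W))) (ha : 0 < a) (φ : Tor M → Fin d → ℂ) :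
    blockSpin (avg n M Qm) (ScV n M R G) φ = (star (unc φ) ⬝ᵥ (effV n M R Gm Qm a *ᵥ unc φ)).re := by
  have hrel : blockSpin Qm.mulVec (qform (KV n M R Gm)) (ucEquiv _ _ φ) = blockSpin (avg n M Qm) (ScV n M R G) φ :=
    blockSpin_relabel (ucEquiv _ _) (ucEquiv _ _) (fun W => rfl) (fun W => (ScV_eq_qform n M R hG W).symm) φ
  rw [← hrel]
  exact blockSpin_eq_effOp (KV_posSemidef n M R hGm) hQ (ker_of_coercive n M R hG hP) ha (unc φ)

end Effective

/-! ## §5 The vector tower END modulo the per-level brackets -/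

section Tower

variable (L : ℕ) [NeZero L] (M : Fin d → ℕ) [hM : ∀ μ, NeZero (M μ)]
variable (R : (k : ℕ) → Tor (fine (L ^ k) M) → Fin d → (ℂ →L[ℂ] ℂ))
variable (Gm : (k : ℕ) → Matrix (Tor (fine (L ^ k) M) × Fin d) (Tor (fine (L ^ k) M) × Fin d) ℂ)
variable (G : (k : ℕ) → (Tor (fine (L ^ k) M) → Fin d → ℂ) → ℝ)
variable (Qm : (k : ℕ) → Matrix (Tor M × Fin d) (Tor (fine (L ^ k) M) × Fin d) ℂ)

/-- **ROW NE2's WALL SHAPE FOR THE VECTOR COVARIANT SPECIES, MODULO THE PER-LEVEL BRACKETS**: along `n_k = L^k` with data `(R k, Gm k, Qm k)`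
(`G k = qform (Gm k) ∘ unc`, `Gm k` PSD, `Qm k` onto), leaf-V-P-shaped coercivity at every level and the two one-sided additive brackets between
the consecutive vector block-spin values `Δ^V_k(φ) = blockSpin (avg (Qm k)) (ScV (R k) (G k)) φ` ⟹
`OneStepAveragedLaw (fun _ ↦ 1) 1 (k ↦ X^V_k) (k ↦ max (e k) (e′ k))`. [folklore] -/
theorem oneStepAveragedLaw_effV (hGm : ∀ k, (Gm k).PosSemidef) (hG : ∀ k W, G k W = qform (Gm k) (unc W))
    (hQ : ∀ k, Function.Surjective (Qm k).mulVec) {CP : ℕ → ℝ}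
    (hP : ∀ k W, qWV (L ^ k) M W ≤ CP k * (ScV (L ^ k) M (R k) (G k) W + nsqV M (avg (L ^ k) M (Qm k) W)))
    {a : ℝ} (ha : 0 < a) (e e' : ℕ → ℝ) (he : ∀ k, 0 ≤ e k)
    (hbr : ∀ k φ, blockSpin (avg (L ^ k) M (Qm k)) (ScV (L ^ k) M (R k) (G k)) φ
        ≤ blockSpin (avg (L ^ (k + 1)) M (Qm (k + 1))) (ScV (L ^ (k + 1)) M (R (k + 1)) (G (k + 1))) φ + e k * nsqV M φ ∧
      blockSpin (avg (L ^ (k + 1)) M (Qm (k + 1))) (ScV (L ^ (k + 1)) M (R (k + 1)) (G (k + 1))) φ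
        ≤ blockSpin (avg (L ^ k) M (Qm k)) (ScV (L ^ k) M (R k) (G k)) φ + e' k * nsqV M φ) :
    OneStepAveragedLaw (ι := fun _ => Tor M × Fin d) (fun _ => (1 : Matrix (Tor M × Fin d) (Tor M × Fin d) ℂ)) 1
      (fun k => effV (L ^ k) M (R k) (Gm k) (Qm k) a) (fun k => max (e k) (e' k)) := by
  refine oneStepAveragedLaw_effOp (fun k => KV (L ^ k) M (R k) (Gm k)) Qm (fun k => KV_posSemidef (L ^ k) M (R k) (hGm k)) hQ
    (fun k => ker_of_coercive (L ^ k) M (R k) (hG k) (hP k)) ha e e' he fun k μ => ?_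
  have h1 : ∀ k, blockSpin (Qm k).mulVec (qform (KV (L ^ k) M (R k) (Gm k))) μ
      = blockSpin (avg (L ^ k) M (Qm k)) (ScV (L ^ k) M (R k) (G k)) (cur μ) := fun k =>
    blockSpin_relabel (ucEquiv _ _) (ucEquiv _ _) (fun W => rfl) (fun W => (ScV_eq_qform (L ^ k) M (R k) (hG k) W).symm) (cur μ)
  have h2 : nsq μ = nsqV M (cur μ) := by rw [← nsq_unc, unc_cur]
  rw [h1 k, h1 (k + 1), h2]
  exact hbr k (cur μ)

/-- **… AND THE SPINE's η-RATE CURRENCY FOR THE VECTOR SPECIES**: GEOMETRIC per-level brackets (`e k, e′ k ≤ C·ρ^k`, `ρ < 1`) give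
`TowerLimitRate (fun _ ↦ 1) 1 (k ↦ X^V_k) C ρ` — the vector effective operators CONVERGE on the unit index `Tor M × Fin d` with
`‖X^V_k − X^V_∞‖ ≤ C·ρ^k/(1 − ρ)` (skeleton §0's target R for the vector covariant species, MODULO the vector leaves). [folklore] -/
theorem towerLimitRate_effV (hGm : ∀ k, (Gm k).PosSemidef) (hG : ∀ k W, G k W = qform (Gm k) (unc W))
    (hQ : ∀ k, Function.Surjective (Qm k).mulVec) {CP : ℕ → ℝ}
    (hP : ∀ k W, qWV (L ^ k) M W ≤ CP k * (ScV (L ^ k) M (R k) (G k) W + nsqV M (avg (L ^ k) M (Qm k) W)))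
    {a : ℝ} (ha : 0 < a) {C ρ : ℝ} (hC : 0 ≤ C) (hρ : 0 ≤ ρ) (hρ1 : ρ < 1) (e e' : ℕ → ℝ) (he : ∀ k, e k ≤ C * ρ ^ k) (he' : ∀ k, e' k ≤ C * ρ ^ k)
    (hbr : ∀ k φ, blockSpin (avg (L ^ k) M (Qm k)) (ScV (L ^ k) M (R k) (G k)) φ
        ≤ blockSpin (avg (L ^ (k + 1)) M (Qm (k + 1))) (ScV (L ^ (k + 1)) M (R (k + 1)) (G (k + 1))) φ + e k * nsqV M φ ∧
      blockSpin (avg (L ^ (k + 1)) M (Qm (k + 1))) (ScV (L ^ (k + 1)) M (R (k + 1)) (G (k + 1))) φ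
        ≤ blockSpin (avg (L ^ k) M (Qm k)) (ScV (L ^ k) M (R k) (G k)) φ + e' k * nsqV M φ) :
    TowerLimitRate (ι := fun _ => Tor M × Fin d) (fun _ => (1 : Matrix (Tor M × Fin d) (Tor M × Fin d) ℂ)) 1
      (fun k => effV (L ^ k) M (R k) (Gm k) (Qm k) a) C ρ := by
  have hbr' : ∀ k φ, blockSpin (avg (L ^ k) M (Qm k)) (ScV (L ^ k) M (R k) (G k)) φ
        ≤ blockSpin (avg (L ^ (k + 1)) M (Qm (k + 1))) (ScV (L ^ (k + 1)) M (R (k + 1)) (G (k + 1))) φ + C * ρ ^ k * nsqV M φ ∧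
      blockSpin (avg (L ^ (k + 1)) M (Qm (k + 1))) (ScV (L ^ (k + 1)) M (R (k + 1)) (G (k + 1))) φ
        ≤ blockSpin (avg (L ^ k) M (Qm k)) (ScV (L ^ k) M (R k) (G k)) φ + C * ρ ^ k * nsqV M φ := fun k φ => by
    have h := hbr k φ
    have hn := nsqV_nonneg M φ
    exact ⟨h.1.trans (by nlinarith [he k]), h.2.trans (by nlinarith [he' k])⟩
  have hlaw := oneStepAveragedLaw_effV L M R Gm G Qm hGm hG hQ hP ha (fun k => C * ρ ^ k) (fun k => C * ρ ^ k)
    (fun k => by positivity) hbr'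
  simp only [max_self] at hlaw
  refine towerLimitRate_of_oneStepAveragedLaw _ one_pos (fun k => ?_) _ hρ1 hlaw
  rw [inv_one]
  calc ‖(1 : Matrix (Tor M × Fin d) (Tor M × Fin d) ℂ)‖ ^ 2 ≤ (1 : ℝ) ^ 2 :=
        pow_le_pow_left₀ (norm_nonneg _) (opNorm_one_le (ι := fun _ => Tor M × Fin d) k) 2
    _ = 1 := one_pow 2

end Tower

end Summit.QuantumFields.BalabanUV.T4Continuum.VariationalVectorEffective

end
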